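import Summits.HodgeConjecture.HodgeConjecture.Theorems.Ring2WeilCoverageRealUnitNormLevels40and52
import Summits.HodgeConjecture.HodgeConjecture.Theorems.Ring2WeilCoverageTypeNormSignPrincipal
import Summits.HodgeConjecture.HodgeConjecture.Theorems.Ring2WeilCoverageNonPrincipalLatticeLevel52
import Summits.HodgeConjecture.HodgeConjecture.Theorems.Ring2WeilCoverageNonPrincipalLatticeRows
import Summits.HodgeConjecture.HodgeConjecture.Theorems.Ring2WeilCoverageCyclotomicSignaturesG8A
import Summits.HodgeConjecture.HodgeConjecture.Theorems.Ring2WeilCoverageCyclotomicSignaturesG12B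
import Summits.HodgeConjecture.HodgeConjecture.Theorems.Ring2WeilCoverageCMTypeSetOddPositions
import HarnessLib

/-!
# Weil-type family coverage — THE NORM-SIGN LAW AT THE LEVELS 40, 52, NOW TWO-SIDED: on every census row `(ℚ(ζ_M), K)`
# the `ι`-compatible polarisation types `(ϖ₀)` carried by the `K`-balanced points `ℂ^Φ/Φ(ℤ[ζ_M])` (and, at `52`, by the
# points on the two non-principal lattice classes) are EXACTLY the real generators `ϖ₀` with `N(ϖ₀) > 0`

research route conditional on HC_CM; not a corollary; Q11.4-sentence-2 already refuted in dim ≥ 3.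

Ring 2, WEIL-TYPE FAMILY-COVERAGE CENSUS (`HOME/WEIL-FAMILY-COVERAGE.md` `## b01`, blocks b01.28 THEOREM L, b01.41–b01.42 (the
norm-sign law); owner ring2-b01), part 64 of the `Ring2WeilCoverage*` series.  Parts 56d (`…TypeNormSignLevelsG8A`), 56g
(`…TypeNormSignLevel52`) and 56h (`…TypeNormSignNonPrincipalLattices`, level `52`) could state only the EXISTENCE half of the
norm-sign law at `40` and `52` («`N_{K⁺/ℚ}(ϖ₀) > 0` ⇒ type `(ϖ₀)` occurs»), THEOREM L (i) being absent at these levels.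
Part 63 (`…RealUnitNormLevels40and52`) proves THEOREM L (i) at `40` and `52` (reduction modulo `5`, resp. `13`), so part
55b's two-sided engine `exists_type_span_iff_norm_pos_of_even` applies exactly as at `48/60/72/84` (parts 56e/56f):

* YES rows `(40, ℚ(i))`, `(40, ℚ(√−2))`, `(40, ℚ(√−5))`, `(40, ℚ(√−10))`, `(52, ℚ(i))`, `(52, ℚ(√−13))`: for every
  `K`-balanced `Φ` and EVERY `ϖ₀ ∈ 𝓞 K⁺ ∖ 0`: **type `(ϖ₀)` occurs ⟺ `N_{K⁺/ℚ}(ϖ₀) > 0`** — no generator of negative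
  norm gives a type;
* every CM type `Φ` at `40`, `52`: `N(ϖ₀) < 0` ⇒ exactly one of «principal», «type `(ϖ₀)`»; `N(ϖ₀) > 0` ⇒ both or
  neither;
* the same on the non-principal classes `[𝔔], [𝔔^ρ]` of `ℤ[ζ₅₂]` (parts 45/46's transfer, as in part 56h).

`h(ℚ(ζ₄₀)) = 1`; `h(ℚ(ζ₅₂)) = 3` with `h(ℚ(ζ₅₂)⁺) = 1` (part 46: the classes `[𝔬], [𝔔], [𝔔^ρ]`), so every type
`𝔣₀ ⊆ 𝓞 K⁺` is principal and these rows list ALL `ι`-compatible polarisation types of all `K`-balanced `ℤ[ζ_M]`-points at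
`40` and `52` (S-pencil remark; the kernel statements quantify over principal types `(ϖ₀)`).  With parts 56a–c/e/f/h the
norm-sign law is now two-sided at EVERY census level except `32`, where every type occurs (part 61).

HONEST FRAMING: torus-level statements about Shimura's divisors of type `(K; Φ; 𝔣₀)` [Sh98 §14.3 Prop. 4–5] and norms of
elements of `ℚ(ζ_M)⁺`; nothing about Hodge classes, `W_K`, general members or HC; `HC_CM` is used nowhere.  No `def`, no
named fact, no `sorry`.  References: [cite: Shimura1998, §14.3 Prop. 4–5, pp. 103–104; §14.4 Prop. 7, p. 105]; [cite: Washington1997, Thm. 11.1]; census b01.42 (seat-derived).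
-/

noncomputable section

open Polynomial NumberField Complex Finset FractionalIdeal
open scoped Real nonZeroDivisors

namespace Summit.HodgeConjecture.Ring2WeilCoverage.TypeNormSignLevels40and52

open Literature.AlgebraicGeometry.Motives (CMType)
open Literature.AlgebraicGeometry.HodgeTheory (IsCMTypeSet)
open Literature.AlgebraicGeometry.ComplexMultiplication.CyclotomicCMType (isCMTypeSet_residueFilter)
open Literature.NumberTheory.ComplexMultiplication
open Summit.HodgeConjecture.Ring2WeilCoverage.TypeNormSign
open Summit.HodgeConjecture.Ring2WeilCoverage.CyclotomicDifferent (xi_ne_zero isOfType_one_xi_top)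
open Summit.HodgeConjecture.Ring2WeilCoverage.CyclotomicPrincipalObstruction (complexConj_xi)
open Summit.HodgeConjecture.Ring2WeilCoverage.CMTypeSetOddPositions (card_inter_nodd_mod_two_eq)
open Summit.HodgeConjecture.Ring2WeilCoverage.RealUnitNormLevels40and52 (norm_realUnits_pos_forty norm_realUnits_pos_fiftyTwo)
open Summit.HodgeConjecture.Ring2WeilCoverage.CyclotomicSignaturesG8A (exists_units_sign_eq_forty)
open Summit.HodgeConjecture.Ring2WeilCoverage.CyclotomicSignaturesG12B (exists_units_sign_eq_fiftyTwo)
open Summit.HodgeConjecture.Ring2WeilCoverage.NonPrincipalLatticeRows (exists_pos_isOfType_iff_of_totallyPositive)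

variable {K : Type} [Field K] [NumberField K] [IsCMField K] {ζ : K}

/-- `𝐞(t) = exp(2πi t/n) ∈ ℂ` (`ZMod.toCircle`). -/
local notation3 (prettyPrint := false) "𝐞 " t:max => ((ZMod.toCircle t : Circle) : ℂ)

/-! ### Level `40` (`g = 16`) -/

section Level40

/-- the residue set `S_Φ` read at level `40`. -/
local notation3 (prettyPrint := false) "SΦ40[" Φ "," z "]" =>
  (Finset.univ.filter fun t : ZMod 40 => ∃ σ ∈ (Φ : CMType K).1, σ (z : K) = 𝐞 t)

open scoped Classical in
/-- **CENSUS ROW `(ℚ(ζ_40), ℚ(i))` — THE TYPE SPECTRUM, NOW TWO-SIDED (a YES row: an `ι`-compatible principal polarisation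
exists).**  For every CM type `Φ` of `ℚ(ζ_40)` balanced for `N_K = [3, 7, 11, 19, 23, 27, 31, 39]` (the Weil signature `(8,8)` on `K = ℚ(i)`)
and EVERY real integer `ϖ₀ ∈ 𝓞 K⁺ ∖ 0` (`K⁺ = ℚ(ζ_40)⁺`): `ℂ^Φ/Φ(ℤ[ζ_40])` carries a `Φ`-positive divisor of type
`(K; Φ; (ϖ₀))` — an `ι`-compatible polarisation of degree `|N_{K⁺/ℚ}(ϖ₀)|` — **iff `N_{K⁺/ℚ}(ϖ₀) > 0`** (part 55b
`exists_type_span_iff_norm_pos_of_even` + THEOREM L (i) at `40` (part 63) + THEOREM L (ii) at `40` + `|S_Φ ∩ N_odd| ≡ n₋ =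
4`).  Part 56d had only the direction «`N(ϖ₀) > 0` ⇒ type `(ϖ₀)`»; now NO generator of negative norm gives a type.
research route conditional on HC_CM; not a corollary; Q11.4-sentence-2 already refuted in dim ≥ 3. [cite: Shimura1998, §14.3 Prop. 4–5, pp. 103–104] -/
theorem exists_type_iff_norm_pos_forty_sqrt_neg_one [IsCyclotomicExtension {40} ℚ K] (hζ : IsPrimitiveRoot ζ 40)
    (Φ : CMType K) (hbal : 2 * (SΦ40[Φ, ζ] ∩ ({3, 7, 11, 19, 23, 27, 31, 39} : Finset (ZMod 40))).card = (SΦ40[Φ, ζ]).card)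
    {ϖ₀ : 𝓞 (maximalRealSubfield K)} (hϖ0 : ϖ₀ ≠ 0) :
    (∃ ζ' : K, IsCMField.complexConj K ζ' = -ζ' ∧ (∀ φ : Φ.1, 0 < (φ.1 ζ').im) ∧
        CMTypeLattice.IsOfType (1 : (FractionalIdeal (𝓞 K)⁰ K)ˣ) ζ' (Ideal.span {ϖ₀})) ↔
      0 < Algebra.norm ℚ ((ϖ₀ : maximalRealSubfield K)) := by
  have hg : Nat.totient 40 = 2 * (7 + 1) := by decide
  refine exists_type_span_iff_norm_pos_of_even hζ hg Φ hϖ0 (norm_realUnits_pos_forty hζ) (exists_units_sign_eq_forty hζ Φ) ?_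
  have hS := isCMTypeSet_residueFilter hζ Φ
  have hNK : IsCMTypeSet 40 ({3, 7, 11, 19, 23, 27, 31, 39} : Finset (ZMod 40)) := by decide
  have h := card_inter_nodd_mod_two_eq (m := 40) (by norm_num) hS hNK hbal
  have hn : ((({3, 7, 11, 19, 23, 27, 31, 39} : Finset (ZMod 40))).filter fun t : ZMod 40 => 2 * t.val < 40).card % 2 = 0 := by
    decide
  rw [hn] at h
  exact Nat.even_iff.mpr h

open scoped Classical in
/-- **CENSUS ROW `(ℚ(ζ_40), ℚ(√−2))` — THE TYPE SPECTRUM, NOW TWO-SIDED (a YES row: an `ι`-compatible principal polarisation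
exists).**  For every CM type `Φ` of `ℚ(ζ_40)` balanced for `N_K = [7, 13, 21, 23, 29, 31, 37, 39]` (the Weil signature `(8,8)` on `K = ℚ(√−2)`)
and EVERY real integer `ϖ₀ ∈ 𝓞 K⁺ ∖ 0` (`K⁺ = ℚ(ζ_40)⁺`): `ℂ^Φ/Φ(ℤ[ζ_40])` carries a `Φ`-positive divisor of type
`(K; Φ; (ϖ₀))` — an `ι`-compatible polarisation of degree `|N_{K⁺/ℚ}(ϖ₀)|` — **iff `N_{K⁺/ℚ}(ϖ₀) > 0`** (part 55b
`exists_type_span_iff_norm_pos_of_even` + THEOREM L (i) at `40` (part 63) + THEOREM L (ii) at `40` + `|S_Φ ∩ N_odd| ≡ n₋ =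
2`).  Part 56d had only the direction «`N(ϖ₀) > 0` ⇒ type `(ϖ₀)`»; now NO generator of negative norm gives a type.
research route conditional on HC_CM; not a corollary; Q11.4-sentence-2 already refuted in dim ≥ 3. [cite: Shimura1998, §14.3 Prop. 4–5, pp. 103–104] -/
theorem exists_type_iff_norm_pos_forty_sqrt_neg_two [IsCyclotomicExtension {40} ℚ K] (hζ : IsPrimitiveRoot ζ 40)
    (Φ : CMType K) (hbal : 2 * (SΦ40[Φ, ζ] ∩ ({7, 13, 21, 23, 29, 31, 37, 39} : Finset (ZMod 40))).card = (SΦ40[Φ, ζ]).card)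
    {ϖ₀ : 𝓞 (maximalRealSubfield K)} (hϖ0 : ϖ₀ ≠ 0) :
    (∃ ζ' : K, IsCMField.complexConj K ζ' = -ζ' ∧ (∀ φ : Φ.1, 0 < (φ.1 ζ').im) ∧
        CMTypeLattice.IsOfType (1 : (FractionalIdeal (𝓞 K)⁰ K)ˣ) ζ' (Ideal.span {ϖ₀})) ↔
      0 < Algebra.norm ℚ ((ϖ₀ : maximalRealSubfield K)) := by
  have hg : Nat.totient 40 = 2 * (7 + 1) := by decide
  refine exists_type_span_iff_norm_pos_of_even hζ hg Φ hϖ0 (norm_realUnits_pos_forty hζ) (exists_units_sign_eq_forty hζ Φ) ?_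
  have hS := isCMTypeSet_residueFilter hζ Φ
  have hNK : IsCMTypeSet 40 ({7, 13, 21, 23, 29, 31, 37, 39} : Finset (ZMod 40)) := by decide
  have h := card_inter_nodd_mod_two_eq (m := 40) (by norm_num) hS hNK hbal
  have hn : ((({7, 13, 21, 23, 29, 31, 37, 39} : Finset (ZMod 40))).filter fun t : ZMod 40 => 2 * t.val < 40).card % 2 = 0 := by
    decide
  rw [hn] at h
  exact Nat.even_iff.mpr h

open scoped Classical in
/-- **CENSUS ROW `(ℚ(ζ_40), ℚ(√−5))` — THE TYPE SPECTRUM, NOW TWO-SIDED (a YES row: an `ι`-compatible principal polarisation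
exists).**  For every CM type `Φ` of `ℚ(ζ_40)` balanced for `N_K = [11, 13, 17, 19, 31, 33, 37, 39]` (the Weil signature `(8,8)` on `K = ℚ(√−5)`)
and EVERY real integer `ϖ₀ ∈ 𝓞 K⁺ ∖ 0` (`K⁺ = ℚ(ζ_40)⁺`): `ℂ^Φ/Φ(ℤ[ζ_40])` carries a `Φ`-positive divisor of type
`(K; Φ; (ϖ₀))` — an `ι`-compatible polarisation of degree `|N_{K⁺/ℚ}(ϖ₀)|` — **iff `N_{K⁺/ℚ}(ϖ₀) > 0`** (part 55b
`exists_type_span_iff_norm_pos_of_even` + THEOREM L (i) at `40` (part 63) + THEOREM L (ii) at `40` + `|S_Φ ∩ N_odd| ≡ n₋ =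
4`).  Part 56d had only the direction «`N(ϖ₀) > 0` ⇒ type `(ϖ₀)`»; now NO generator of negative norm gives a type.
research route conditional on HC_CM; not a corollary; Q11.4-sentence-2 already refuted in dim ≥ 3. [cite: Shimura1998, §14.3 Prop. 4–5, pp. 103–104] -/
theorem exists_type_iff_norm_pos_forty_sqrt_neg_five [IsCyclotomicExtension {40} ℚ K] (hζ : IsPrimitiveRoot ζ 40)
    (Φ : CMType K) (hbal : 2 * (SΦ40[Φ, ζ] ∩ ({11, 13, 17, 19, 31, 33, 37, 39} : Finset (ZMod 40))).card = (SΦ40[Φ, ζ]).card)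
    {ϖ₀ : 𝓞 (maximalRealSubfield K)} (hϖ0 : ϖ₀ ≠ 0) :
    (∃ ζ' : K, IsCMField.complexConj K ζ' = -ζ' ∧ (∀ φ : Φ.1, 0 < (φ.1 ζ').im) ∧
        CMTypeLattice.IsOfType (1 : (FractionalIdeal (𝓞 K)⁰ K)ˣ) ζ' (Ideal.span {ϖ₀})) ↔
      0 < Algebra.norm ℚ ((ϖ₀ : maximalRealSubfield K)) := by
  have hg : Nat.totient 40 = 2 * (7 + 1) := by decide
  refine exists_type_span_iff_norm_pos_of_even hζ hg Φ hϖ0 (norm_realUnits_pos_forty hζ) (exists_units_sign_eq_forty hζ Φ) ?_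
  have hS := isCMTypeSet_residueFilter hζ Φ
  have hNK : IsCMTypeSet 40 ({11, 13, 17, 19, 31, 33, 37, 39} : Finset (ZMod 40)) := by decide
  have h := card_inter_nodd_mod_two_eq (m := 40) (by norm_num) hS hNK hbal
  have hn : ((({11, 13, 17, 19, 31, 33, 37, 39} : Finset (ZMod 40))).filter fun t : ZMod 40 => 2 * t.val < 40).card % 2 = 0 := by
    decide
  rw [hn] at h
  exact Nat.even_iff.mpr h

open scoped Classical in
/-- **CENSUS ROW `(ℚ(ζ_40), ℚ(√−10))` — THE TYPE SPECTRUM, NOW TWO-SIDED (a YES row: an `ι`-compatible principal polarisation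
exists).**  For every CM type `Φ` of `ℚ(ζ_40)` balanced for `N_K = [3, 17, 21, 27, 29, 31, 33, 39]` (the Weil signature `(8,8)` on `K = ℚ(√−10)`)
and EVERY real integer `ϖ₀ ∈ 𝓞 K⁺ ∖ 0` (`K⁺ = ℚ(ζ_40)⁺`): `ℂ^Φ/Φ(ℤ[ζ_40])` carries a `Φ`-positive divisor of type
`(K; Φ; (ϖ₀))` — an `ι`-compatible polarisation of degree `|N_{K⁺/ℚ}(ϖ₀)|` — **iff `N_{K⁺/ℚ}(ϖ₀) > 0`** (part 55b
`exists_type_span_iff_norm_pos_of_even` + THEOREM L (i) at `40` (part 63) + THEOREM L (ii) at `40` + `|S_Φ ∩ N_odd| ≡ n₋ =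
2`).  Part 56d had only the direction «`N(ϖ₀) > 0` ⇒ type `(ϖ₀)`»; now NO generator of negative norm gives a type.
research route conditional on HC_CM; not a corollary; Q11.4-sentence-2 already refuted in dim ≥ 3. [cite: Shimura1998, §14.3 Prop. 4–5, pp. 103–104] -/
theorem exists_type_iff_norm_pos_forty_sqrt_neg_ten [IsCyclotomicExtension {40} ℚ K] (hζ : IsPrimitiveRoot ζ 40)
    (Φ : CMType K) (hbal : 2 * (SΦ40[Φ, ζ] ∩ ({3, 17, 21, 27, 29, 31, 33, 39} : Finset (ZMod 40))).card = (SΦ40[Φ, ζ]).card)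
    {ϖ₀ : 𝓞 (maximalRealSubfield K)} (hϖ0 : ϖ₀ ≠ 0) :
    (∃ ζ' : K, IsCMField.complexConj K ζ' = -ζ' ∧ (∀ φ : Φ.1, 0 < (φ.1 ζ').im) ∧
        CMTypeLattice.IsOfType (1 : (FractionalIdeal (𝓞 K)⁰ K)ˣ) ζ' (Ideal.span {ϖ₀})) ↔
      0 < Algebra.norm ℚ ((ϖ₀ : maximalRealSubfield K)) := by
  have hg : Nat.totient 40 = 2 * (7 + 1) := by decide
  refine exists_type_span_iff_norm_pos_of_even hζ hg Φ hϖ0 (norm_realUnits_pos_forty hζ) (exists_units_sign_eq_forty hζ Φ) ?_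
  have hS := isCMTypeSet_residueFilter hζ Φ
  have hNK : IsCMTypeSet 40 ({3, 17, 21, 27, 29, 31, 33, 39} : Finset (ZMod 40)) := by decide
  have h := card_inter_nodd_mod_two_eq (m := 40) (by norm_num) hS hNK hbal
  have hn : ((({3, 17, 21, 27, 29, 31, 33, 39} : Finset (ZMod 40))).filter fun t : ZMod 40 => 2 * t.val < 40).card % 2 = 0 := by
    decide
  rw [hn] at h
  exact Nat.even_iff.mpr h

/-- **DICHOTOMY AT LEVEL `40` for EVERY real generator of NEGATIVE norm**: for every one of the `2^16` CM types `Φ` of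
`ℚ(ζ_40)` and every `ϖ₀ ∈ 𝓞 K⁺` with `N_{K⁺/ℚ}(ϖ₀) < 0`, the torus `ℂ^Φ/Φ(ℤ[ζ_40])` carries EITHER an `ι`-compatible
principal polarisation OR a `Φ`-positive divisor of type `(ϖ₀)`, NEVER BOTH (part 55b `xor_principal_span_of_norm_neg` +
THEOREM L (i)/(ii) at `40`).
research route conditional on HC_CM; not a corollary; Q11.4-sentence-2 already refuted in dim ≥ 3. [cite: Shimura1998, §14.3 Prop. 4–5, pp. 103–104] -/
theorem xor_principal_type_forty_of_norm_neg [IsCyclotomicExtension {40} ℚ K] (hζ : IsPrimitiveRoot ζ 40)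
    (Φ : CMType K) {ϖ₀ : 𝓞 (maximalRealSubfield K)} (hneg : Algebra.norm ℚ ((ϖ₀ : maximalRealSubfield K)) < 0) :
    Xor (∃ ζ' : K, IsCMField.complexConj K ζ' = -ζ' ∧ (∀ φ : Φ.1, 0 < (φ.1 ζ').im) ∧
          CMTypeLattice.IsOfType (1 : (FractionalIdeal (𝓞 K)⁰ K)ˣ) ζ' ⊤)
      (∃ ζ' : K, IsCMField.complexConj K ζ' = -ζ' ∧ (∀ φ : Φ.1, 0 < (φ.1 ζ').im) ∧
        CMTypeLattice.IsOfType (1 : (FractionalIdeal (𝓞 K)⁰ K)ˣ) ζ' (Ideal.span {ϖ₀})) := by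
  have hg : Nat.totient 40 = 2 * (7 + 1) := by decide
  exact xor_principal_span_of_norm_neg Φ 1 (complexConj_xi hζ hg) (xi_ne_zero hζ 7) (isOfType_one_xi_top hζ 7) hneg
    (norm_realUnits_pos_forty hζ) (exists_units_sign_eq_forty hζ Φ)

/-- **POSITIVE norm at level `40`**: for every CM type `Φ` of `ℚ(ζ_40)` and every `ϖ₀ ∈ 𝓞 K⁺` with `N_{K⁺/ℚ}(ϖ₀) > 0`,
type `(ϖ₀)` occurs on `ℂ^Φ/Φ(ℤ[ζ_40])` iff an `ι`-compatible principal polarisation does (part 55b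
`exists_pos_isOfType_span_iff_principal_of_norm_pos` + THEOREM L (i)/(ii) at `40`).
research route conditional on HC_CM; not a corollary; Q11.4-sentence-2 already refuted in dim ≥ 3. [cite: Shimura1998, §14.3 Prop. 4–5, pp. 103–104] -/
theorem exists_type_iff_principal_forty_of_norm_pos [IsCyclotomicExtension {40} ℚ K] (hζ : IsPrimitiveRoot ζ 40)
    (Φ : CMType K) {ϖ₀ : 𝓞 (maximalRealSubfield K)} (hpos : 0 < Algebra.norm ℚ ((ϖ₀ : maximalRealSubfield K))) :
    (∃ ζ' : K, IsCMField.complexConj K ζ' = -ζ' ∧ (∀ φ : Φ.1, 0 < (φ.1 ζ').im) ∧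
        CMTypeLattice.IsOfType (1 : (FractionalIdeal (𝓞 K)⁰ K)ˣ) ζ' (Ideal.span {ϖ₀})) ↔
      (∃ ζ' : K, IsCMField.complexConj K ζ' = -ζ' ∧ (∀ φ : Φ.1, 0 < (φ.1 ζ').im) ∧
          CMTypeLattice.IsOfType (1 : (FractionalIdeal (𝓞 K)⁰ K)ˣ) ζ' ⊤) := by
  have hg : Nat.totient 40 = 2 * (7 + 1) := by decide
  exact exists_pos_isOfType_span_iff_principal_of_norm_pos Φ 1 (complexConj_xi hζ hg) (xi_ne_zero hζ 7)
    (isOfType_one_xi_top hζ 7) hpos (norm_realUnits_pos_forty hζ) (exists_units_sign_eq_forty hζ Φ)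

end Level40

/-! ### Level `52` (`g = 24`) -/

section Level52

/-- the residue set `S_Φ` read at level `52`. -/
local notation3 (prettyPrint := false) "SΦ52[" Φ "," z "]" =>
  (Finset.univ.filter fun t : ZMod 52 => ∃ σ ∈ (Φ : CMType K).1, σ (z : K) = 𝐞 t)
/-- part 46's lattice `𝔔 = (1 − ζ⁴, 3 + 2ζ¹³) ⊂ 𝓞 K` (a prime over `13`). -/
local notation3 (prettyPrint := false) "𝔔[" hζ "]" =>
  (Ideal.span {1 - IsPrimitiveRoot.toInteger hζ ^ 4, 3 + 2 * IsPrimitiveRoot.toInteger hζ ^ 13} : Ideal (𝓞 K))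
/-- its conjugate `𝔔^ρ = (1 − ζ⁴⁸, 3 + 2ζ³⁹)`. -/
local notation3 (prettyPrint := false) "𝔔ρ[" hζ "]" =>
  (Ideal.span {1 - IsPrimitiveRoot.toInteger hζ ^ 48, 3 + 2 * IsPrimitiveRoot.toInteger hζ ^ 39} : Ideal (𝓞 K))

open scoped Classical in
/-- **CENSUS ROW `(ℚ(ζ_52), ℚ(i))` — THE TYPE SPECTRUM, NOW TWO-SIDED (a YES row: an `ι`-compatible principal polarisation
exists).**  For every CM type `Φ` of `ℚ(ζ_52)` balanced for `N_K = [3, 7, 11, 15, 19, 23, 27, 31, 35, 43, 47, 51]` (the Weil signature `(12,12)` on `K = ℚ(i)`)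
and EVERY real integer `ϖ₀ ∈ 𝓞 K⁺ ∖ 0` (`K⁺ = ℚ(ζ_52)⁺`): `ℂ^Φ/Φ(ℤ[ζ_52])` carries a `Φ`-positive divisor of type
`(K; Φ; (ϖ₀))` — an `ι`-compatible polarisation of degree `|N_{K⁺/ℚ}(ϖ₀)|` — **iff `N_{K⁺/ℚ}(ϖ₀) > 0`** (part 55b
`exists_type_span_iff_norm_pos_of_even` + THEOREM L (i) at `52` (part 63) + THEOREM L (ii) at `52` + `|S_Φ ∩ N_odd| ≡ n₋ =
6`).  Part 56g had only the direction «`N(ϖ₀) > 0` ⇒ type `(ϖ₀)`»; now NO generator of negative norm gives a type.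
research route conditional on HC_CM; not a corollary; Q11.4-sentence-2 already refuted in dim ≥ 3. [cite: Shimura1998, §14.3 Prop. 4–5, pp. 103–104] -/
theorem exists_type_iff_norm_pos_fiftyTwo_sqrt_neg_one [IsCyclotomicExtension {52} ℚ K] (hζ : IsPrimitiveRoot ζ 52)
    (Φ : CMType K) (hbal : 2 * (SΦ52[Φ, ζ] ∩ ({3, 7, 11, 15, 19, 23, 27, 31, 35, 43, 47, 51} : Finset (ZMod 52))).card = (SΦ52[Φ, ζ]).card)
    {ϖ₀ : 𝓞 (maximalRealSubfield K)} (hϖ0 : ϖ₀ ≠ 0) :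
    (∃ ζ' : K, IsCMField.complexConj K ζ' = -ζ' ∧ (∀ φ : Φ.1, 0 < (φ.1 ζ').im) ∧
        CMTypeLattice.IsOfType (1 : (FractionalIdeal (𝓞 K)⁰ K)ˣ) ζ' (Ideal.span {ϖ₀})) ↔
      0 < Algebra.norm ℚ ((ϖ₀ : maximalRealSubfield K)) := by
  have hg : Nat.totient 52 = 2 * (11 + 1) := by decide
  refine exists_type_span_iff_norm_pos_of_even hζ hg Φ hϖ0 (norm_realUnits_pos_fiftyTwo hζ) (exists_units_sign_eq_fiftyTwo hζ Φ) ?_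
  have hS := isCMTypeSet_residueFilter hζ Φ
  have hNK : IsCMTypeSet 52 ({3, 7, 11, 15, 19, 23, 27, 31, 35, 43, 47, 51} : Finset (ZMod 52)) := by decide
  have h := card_inter_nodd_mod_two_eq (m := 52) (by norm_num) hS hNK hbal
  have hn : ((({3, 7, 11, 15, 19, 23, 27, 31, 35, 43, 47, 51} : Finset (ZMod 52))).filter fun t : ZMod 52 => 2 * t.val < 52).card % 2 = 0 := by
    decide
  rw [hn] at h
  exact Nat.even_iff.mpr h

open scoped Classical in
/-- **CENSUS ROW `(ℚ(ζ_52), ℚ(√−13))` — THE TYPE SPECTRUM, NOW TWO-SIDED (a YES row: an `ι`-compatible principal polarisation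
exists).**  For every CM type `Φ` of `ℚ(ζ_52)` balanced for `N_K = [3, 5, 21, 23, 27, 33, 35, 37, 41, 43, 45, 51]` (the Weil signature `(12,12)` on `K = ℚ(√−13)`)
and EVERY real integer `ϖ₀ ∈ 𝓞 K⁺ ∖ 0` (`K⁺ = ℚ(ζ_52)⁺`): `ℂ^Φ/Φ(ℤ[ζ_52])` carries a `Φ`-positive divisor of type
`(K; Φ; (ϖ₀))` — an `ι`-compatible polarisation of degree `|N_{K⁺/ℚ}(ϖ₀)|` — **iff `N_{K⁺/ℚ}(ϖ₀) > 0`** (part 55b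
`exists_type_span_iff_norm_pos_of_even` + THEOREM L (i) at `52` (part 63) + THEOREM L (ii) at `52` + `|S_Φ ∩ N_odd| ≡ n₋ =
4`).  Part 56g had only the direction «`N(ϖ₀) > 0` ⇒ type `(ϖ₀)`»; now NO generator of negative norm gives a type.
research route conditional on HC_CM; not a corollary; Q11.4-sentence-2 already refuted in dim ≥ 3. [cite: Shimura1998, §14.3 Prop. 4–5, pp. 103–104] -/
theorem exists_type_iff_norm_pos_fiftyTwo_sqrt_neg_thirteen [IsCyclotomicExtension {52} ℚ K] (hζ : IsPrimitiveRoot ζ 52)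
    (Φ : CMType K) (hbal : 2 * (SΦ52[Φ, ζ] ∩ ({3, 5, 21, 23, 27, 33, 35, 37, 41, 43, 45, 51} : Finset (ZMod 52))).card = (SΦ52[Φ, ζ]).card)
    {ϖ₀ : 𝓞 (maximalRealSubfield K)} (hϖ0 : ϖ₀ ≠ 0) :
    (∃ ζ' : K, IsCMField.complexConj K ζ' = -ζ' ∧ (∀ φ : Φ.1, 0 < (φ.1 ζ').im) ∧
        CMTypeLattice.IsOfType (1 : (FractionalIdeal (𝓞 K)⁰ K)ˣ) ζ' (Ideal.span {ϖ₀})) ↔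
      0 < Algebra.norm ℚ ((ϖ₀ : maximalRealSubfield K)) := by
  have hg : Nat.totient 52 = 2 * (11 + 1) := by decide
  refine exists_type_span_iff_norm_pos_of_even hζ hg Φ hϖ0 (norm_realUnits_pos_fiftyTwo hζ) (exists_units_sign_eq_fiftyTwo hζ Φ) ?_
  have hS := isCMTypeSet_residueFilter hζ Φ
  have hNK : IsCMTypeSet 52 ({3, 5, 21, 23, 27, 33, 35, 37, 41, 43, 45, 51} : Finset (ZMod 52)) := by decide
  have h := card_inter_nodd_mod_two_eq (m := 52) (by norm_num) hS hNK hbal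
  have hn : ((({3, 5, 21, 23, 27, 33, 35, 37, 41, 43, 45, 51} : Finset (ZMod 52))).filter fun t : ZMod 52 => 2 * t.val < 52).card % 2 = 0 := by
    decide
  rw [hn] at h
  exact Nat.even_iff.mpr h

/-- **DICHOTOMY AT LEVEL `52` for EVERY real generator of NEGATIVE norm**: for every one of the `2^24` CM types `Φ` of
`ℚ(ζ_52)` and every `ϖ₀ ∈ 𝓞 K⁺` with `N_{K⁺/ℚ}(ϖ₀) < 0`, the torus `ℂ^Φ/Φ(ℤ[ζ_52])` carries EITHER an `ι`-compatible
principal polarisation OR a `Φ`-positive divisor of type `(ϖ₀)`, NEVER BOTH (part 55b `xor_principal_span_of_norm_neg` +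
THEOREM L (i)/(ii) at `52`).
research route conditional on HC_CM; not a corollary; Q11.4-sentence-2 already refuted in dim ≥ 3. [cite: Shimura1998, §14.3 Prop. 4–5, pp. 103–104] -/
theorem xor_principal_type_fiftyTwo_of_norm_neg [IsCyclotomicExtension {52} ℚ K] (hζ : IsPrimitiveRoot ζ 52)
    (Φ : CMType K) {ϖ₀ : 𝓞 (maximalRealSubfield K)} (hneg : Algebra.norm ℚ ((ϖ₀ : maximalRealSubfield K)) < 0) :
    Xor (∃ ζ' : K, IsCMField.complexConj K ζ' = -ζ' ∧ (∀ φ : Φ.1, 0 < (φ.1 ζ').im) ∧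
          CMTypeLattice.IsOfType (1 : (FractionalIdeal (𝓞 K)⁰ K)ˣ) ζ' ⊤)
      (∃ ζ' : K, IsCMField.complexConj K ζ' = -ζ' ∧ (∀ φ : Φ.1, 0 < (φ.1 ζ').im) ∧
        CMTypeLattice.IsOfType (1 : (FractionalIdeal (𝓞 K)⁰ K)ˣ) ζ' (Ideal.span {ϖ₀})) := by
  have hg : Nat.totient 52 = 2 * (11 + 1) := by decide
  exact xor_principal_span_of_norm_neg Φ 1 (complexConj_xi hζ hg) (xi_ne_zero hζ 11) (isOfType_one_xi_top hζ 11) hneg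
    (norm_realUnits_pos_fiftyTwo hζ) (exists_units_sign_eq_fiftyTwo hζ Φ)

/-- **POSITIVE norm at level `52`**: for every CM type `Φ` of `ℚ(ζ_52)` and every `ϖ₀ ∈ 𝓞 K⁺` with `N_{K⁺/ℚ}(ϖ₀) > 0`,
type `(ϖ₀)` occurs on `ℂ^Φ/Φ(ℤ[ζ_52])` iff an `ι`-compatible principal polarisation does (part 55b
`exists_pos_isOfType_span_iff_principal_of_norm_pos` + THEOREM L (i)/(ii) at `52`).
research route conditional on HC_CM; not a corollary; Q11.4-sentence-2 already refuted in dim ≥ 3. [cite: Shimura1998, §14.3 Prop. 4–5, pp. 103–104] -/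
theorem exists_type_iff_principal_fiftyTwo_of_norm_pos [IsCyclotomicExtension {52} ℚ K] (hζ : IsPrimitiveRoot ζ 52)
    (Φ : CMType K) {ϖ₀ : 𝓞 (maximalRealSubfield K)} (hpos : 0 < Algebra.norm ℚ ((ϖ₀ : maximalRealSubfield K))) :
    (∃ ζ' : K, IsCMField.complexConj K ζ' = -ζ' ∧ (∀ φ : Φ.1, 0 < (φ.1 ζ').im) ∧
        CMTypeLattice.IsOfType (1 : (FractionalIdeal (𝓞 K)⁰ K)ˣ) ζ' (Ideal.span {ϖ₀})) ↔
      (∃ ζ' : K, IsCMField.complexConj K ζ' = -ζ' ∧ (∀ φ : Φ.1, 0 < (φ.1 ζ').im) ∧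
          CMTypeLattice.IsOfType (1 : (FractionalIdeal (𝓞 K)⁰ K)ˣ) ζ' ⊤) := by
  have hg : Nat.totient 52 = 2 * (11 + 1) := by decide
  exact exists_pos_isOfType_span_iff_principal_of_norm_pos Φ 1 (complexConj_xi hζ hg) (xi_ne_zero hζ 11)
    (isOfType_one_xi_top hζ 11) hpos (norm_realUnits_pos_fiftyTwo hζ) (exists_units_sign_eq_fiftyTwo hζ Φ)

open scoped Classical in
/-- **ROW `(ℚ(ζ_52), ℚ(i))` ON THE NON-PRINCIPAL CLASSES `[𝔔], [𝔔^ρ]` — TWO-SIDED**: for every CM type `Φ` balanced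
for `N_K = [3, 7, 11, 15, 19, 23, 27, 31, 35, 43, 47, 51]`, every `𝔪 ∈ {𝔔, 𝔔^ρ}` and EVERY `ϖ₀ ∈ 𝓞 K⁺ ∖ 0`: `ℂ^Φ/Φ(𝔪)` carries a `Φ`-positive
divisor of type `(ϖ₀)` **iff `N_{K⁺/ℚ}(ϖ₀) > 0`** (part 45's transfer `exists_pos_isOfType_iff_of_totallyPositive` with part 46's
`α ≫ 0`, `𝔔𝔔^ρ = (α)`, as in part 56h, + the principal row; part 56h had only «⇒» here).  With `h(ℚ(ζ₅₂)) = 3` (`[𝔬], [𝔔], [𝔔^ρ]`, part 46) and `h(ℚ(ζ₅₂)⁺) = 1` this is the complete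
list of `ι`-compatible polarisation types on ALL `K`-balanced `ℤ[ζ₅₂]`-points (S-pencil remark).
research route conditional on HC_CM; not a corollary; Q11.4-sentence-2 already refuted in dim ≥ 3. [cite: Shimura1998, §14.3 Prop. 4–5, pp. 103–104; §14.4 Prop. 7, p. 105] -/
theorem exists_type_iff_norm_pos_fiftyTwo_sqrt_neg_one_nonprincipal [IsCyclotomicExtension {52} ℚ K] (hζ : IsPrimitiveRoot ζ 52)
    (Φ : CMType K) (hbal : 2 * (SΦ52[Φ, ζ] ∩ ({3, 7, 11, 15, 19, 23, 27, 31, 35, 43, 47, 51} : Finset (ZMod 52))).card = (SΦ52[Φ, ζ]).card)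
    (𝔪 : (FractionalIdeal (𝓞 K)⁰ K)ˣ)
    (h𝔪 : (𝔪 : FractionalIdeal (𝓞 K)⁰ K) = ((𝔔[hζ] : Ideal (𝓞 K)) : FractionalIdeal (𝓞 K)⁰ K) ∨
      (𝔪 : FractionalIdeal (𝓞 K)⁰ K) = ((𝔔ρ[hζ] : Ideal (𝓞 K)) : FractionalIdeal (𝓞 K)⁰ K))
    {ϖ₀ : 𝓞 (maximalRealSubfield K)} (hϖ0 : ϖ₀ ≠ 0) :
    (∃ ζ' : K, IsCMField.complexConj K ζ' = -ζ' ∧ (∀ φ : Φ.1, 0 < (φ.1 ζ').im) ∧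
        CMTypeLattice.IsOfType 𝔪 ζ' (Ideal.span {ϖ₀})) ↔
      0 < Algebra.norm ℚ ((ϖ₀ : maximalRealSubfield K)) := by
  have htr : ∀ 𝔣₀ : Ideal (𝓞 (maximalRealSubfield K)),
      (∃ ζ' : K, IsCMField.complexConj K ζ' = -ζ' ∧ (∀ φ : Φ.1, 0 < (φ.1 ζ').im) ∧ CMTypeLattice.IsOfType 𝔪 ζ' 𝔣₀) ↔
        ∃ ζ' : K, IsCMField.complexConj K ζ' = -ζ' ∧ (∀ φ : Φ.1, 0 < (φ.1 ζ').im) ∧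
          CMTypeLattice.IsOfType (1 : (FractionalIdeal (𝓞 K)⁰ K)ˣ) ζ' 𝔣₀ := fun 𝔣₀ => by
    rcases h𝔪 with h | h
    · exact exists_pos_isOfType_iff_of_totallyPositive Φ 𝔪 (NonPrincipalLatticeLevel52.alpha_real_pos hζ).1
        (NonPrincipalLatticeLevel52.alpha_real_pos hζ).2 (NonPrincipalLatticeLevel52.mul_conjIdeal_eq_of_coe_eq hζ 𝔪 h) 𝔣₀
    · exact exists_pos_isOfType_iff_of_totallyPositive Φ 𝔪 (NonPrincipalLatticeLevel52.alpha_real_pos hζ).1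
        (NonPrincipalLatticeLevel52.alpha_real_pos hζ).2
        (NonPrincipalLatticeLevel52.mul_conjIdeal_eq_of_coe_eq_conj hζ 𝔪 h) 𝔣₀
  rw [htr (Ideal.span {ϖ₀})]
  have hg : Nat.totient 52 = 2 * (11 + 1) := by decide
  refine exists_type_span_iff_norm_pos_of_even hζ hg Φ hϖ0 (norm_realUnits_pos_fiftyTwo hζ) (exists_units_sign_eq_fiftyTwo hζ Φ) ?_
  have hS := isCMTypeSet_residueFilter hζ Φ
  have hNK : IsCMTypeSet 52 ({3, 7, 11, 15, 19, 23, 27, 31, 35, 43, 47, 51} : Finset (ZMod 52)) := by decide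
  have h := card_inter_nodd_mod_two_eq (m := 52) (by norm_num) hS hNK hbal
  have hn : ((({3, 7, 11, 15, 19, 23, 27, 31, 35, 43, 47, 51} : Finset (ZMod 52))).filter fun t : ZMod 52 => 2 * t.val < 52).card % 2 = 0 := by
    decide
  rw [hn] at h
  exact Nat.even_iff.mpr h

open scoped Classical in
/-- **ROW `(ℚ(ζ_52), ℚ(√−13))` ON THE NON-PRINCIPAL CLASSES `[𝔔], [𝔔^ρ]` — TWO-SIDED**: for every CM type `Φ` balanced
for `N_K = [3, 5, 21, 23, 27, 33, 35, 37, 41, 43, 45, 51]`, every `𝔪 ∈ {𝔔, 𝔔^ρ}` and EVERY `ϖ₀ ∈ 𝓞 K⁺ ∖ 0`: `ℂ^Φ/Φ(𝔪)` carries a `Φ`-positive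
divisor of type `(ϖ₀)` **iff `N_{K⁺/ℚ}(ϖ₀) > 0`** (part 45's transfer `exists_pos_isOfType_iff_of_totallyPositive` with part 46's
`α ≫ 0`, `𝔔𝔔^ρ = (α)`, as in part 56h, + the principal row; part 56h had only «⇒» here).  With `h(ℚ(ζ₅₂)) = 3` (`[𝔬], [𝔔], [𝔔^ρ]`, part 46) and `h(ℚ(ζ₅₂)⁺) = 1` this is the complete
list of `ι`-compatible polarisation types on ALL `K`-balanced `ℤ[ζ₅₂]`-points (S-pencil remark).
research route conditional on HC_CM; not a corollary; Q11.4-sentence-2 already refuted in dim ≥ 3. [cite: Shimura1998, §14.3 Prop. 4–5, pp. 103–104; §14.4 Prop. 7, p. 105] -/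
theorem exists_type_iff_norm_pos_fiftyTwo_sqrt_neg_thirteen_nonprincipal [IsCyclotomicExtension {52} ℚ K] (hζ : IsPrimitiveRoot ζ 52)
    (Φ : CMType K) (hbal : 2 * (SΦ52[Φ, ζ] ∩ ({3, 5, 21, 23, 27, 33, 35, 37, 41, 43, 45, 51} : Finset (ZMod 52))).card = (SΦ52[Φ, ζ]).card)
    (𝔪 : (FractionalIdeal (𝓞 K)⁰ K)ˣ)
    (h𝔪 : (𝔪 : FractionalIdeal (𝓞 K)⁰ K) = ((𝔔[hζ] : Ideal (𝓞 K)) : FractionalIdeal (𝓞 K)⁰ K) ∨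
      (𝔪 : FractionalIdeal (𝓞 K)⁰ K) = ((𝔔ρ[hζ] : Ideal (𝓞 K)) : FractionalIdeal (𝓞 K)⁰ K))
    {ϖ₀ : 𝓞 (maximalRealSubfield K)} (hϖ0 : ϖ₀ ≠ 0) :
    (∃ ζ' : K, IsCMField.complexConj K ζ' = -ζ' ∧ (∀ φ : Φ.1, 0 < (φ.1 ζ').im) ∧
        CMTypeLattice.IsOfType 𝔪 ζ' (Ideal.span {ϖ₀})) ↔
      0 < Algebra.norm ℚ ((ϖ₀ : maximalRealSubfield K)) := by
  have htr : ∀ 𝔣₀ : Ideal (𝓞 (maximalRealSubfield K)),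
      (∃ ζ' : K, IsCMField.complexConj K ζ' = -ζ' ∧ (∀ φ : Φ.1, 0 < (φ.1 ζ').im) ∧ CMTypeLattice.IsOfType 𝔪 ζ' 𝔣₀) ↔
        ∃ ζ' : K, IsCMField.complexConj K ζ' = -ζ' ∧ (∀ φ : Φ.1, 0 < (φ.1 ζ').im) ∧
          CMTypeLattice.IsOfType (1 : (FractionalIdeal (𝓞 K)⁰ K)ˣ) ζ' 𝔣₀ := fun 𝔣₀ => by
    rcases h𝔪 with h | h
    · exact exists_pos_isOfType_iff_of_totallyPositive Φ 𝔪 (NonPrincipalLatticeLevel52.alpha_real_pos hζ).1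
        (NonPrincipalLatticeLevel52.alpha_real_pos hζ).2 (NonPrincipalLatticeLevel52.mul_conjIdeal_eq_of_coe_eq hζ 𝔪 h) 𝔣₀
    · exact exists_pos_isOfType_iff_of_totallyPositive Φ 𝔪 (NonPrincipalLatticeLevel52.alpha_real_pos hζ).1
        (NonPrincipalLatticeLevel52.alpha_real_pos hζ).2
        (NonPrincipalLatticeLevel52.mul_conjIdeal_eq_of_coe_eq_conj hζ 𝔪 h) 𝔣₀
  rw [htr (Ideal.span {ϖ₀})]
  have hg : Nat.totient 52 = 2 * (11 + 1) := by decide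
  refine exists_type_span_iff_norm_pos_of_even hζ hg Φ hϖ0 (norm_realUnits_pos_fiftyTwo hζ) (exists_units_sign_eq_fiftyTwo hζ Φ) ?_
  have hS := isCMTypeSet_residueFilter hζ Φ
  have hNK : IsCMTypeSet 52 ({3, 5, 21, 23, 27, 33, 35, 37, 41, 43, 45, 51} : Finset (ZMod 52)) := by decide
  have h := card_inter_nodd_mod_two_eq (m := 52) (by norm_num) hS hNK hbal
  have hn : ((({3, 5, 21, 23, 27, 33, 35, 37, 41, 43, 45, 51} : Finset (ZMod 52))).filter fun t : ZMod 52 => 2 * t.val < 52).card % 2 = 0 := by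
    decide
  rw [hn] at h
  exact Nat.even_iff.mpr h

/-- **DICHOTOMY ON THE NON-PRINCIPAL CLASSES AT `52`**: for EVERY CM type `Φ`, every `𝔪 ∈ {𝔔, 𝔔^ρ}` and every
`ϖ₀ ∈ 𝓞 K⁺` with `N_{K⁺/ℚ}(ϖ₀) < 0`, `ℂ^Φ/Φ(𝔪)` carries EITHER an `ι`-compatible principal polarisation OR a `Φ`-positive
divisor of type `(ϖ₀)`, never both (both sides transfer to the principal torus — parts 45/46 as in part 56h — where part
55b's `xor_principal_span_of_norm_neg` applies with THEOREM L (i)/(ii) at `52`).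
research route conditional on HC_CM; not a corollary; Q11.4-sentence-2 already refuted in dim ≥ 3. [cite: Shimura1998, §14.3 Prop. 4–5, pp. 103–104; §14.4 Prop. 7, p. 105] -/
theorem xor_principal_type_fiftyTwo_nonprincipal_of_norm_neg [IsCyclotomicExtension {52} ℚ K]
    (hζ : IsPrimitiveRoot ζ 52) (Φ : CMType K) (𝔪 : (FractionalIdeal (𝓞 K)⁰ K)ˣ)
    (h𝔪 : (𝔪 : FractionalIdeal (𝓞 K)⁰ K) = ((𝔔[hζ] : Ideal (𝓞 K)) : FractionalIdeal (𝓞 K)⁰ K) ∨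
      (𝔪 : FractionalIdeal (𝓞 K)⁰ K) = ((𝔔ρ[hζ] : Ideal (𝓞 K)) : FractionalIdeal (𝓞 K)⁰ K))
    {ϖ₀ : 𝓞 (maximalRealSubfield K)} (hneg : Algebra.norm ℚ ((ϖ₀ : maximalRealSubfield K)) < 0) :
    Xor (∃ ζ' : K, IsCMField.complexConj K ζ' = -ζ' ∧ (∀ φ : Φ.1, 0 < (φ.1 ζ').im) ∧ CMTypeLattice.IsOfType 𝔪 ζ' ⊤)
      (∃ ζ' : K, IsCMField.complexConj K ζ' = -ζ' ∧ (∀ φ : Φ.1, 0 < (φ.1 ζ').im) ∧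
        CMTypeLattice.IsOfType 𝔪 ζ' (Ideal.span {ϖ₀})) := by
  have htr : ∀ 𝔣₀ : Ideal (𝓞 (maximalRealSubfield K)),
      (∃ ζ' : K, IsCMField.complexConj K ζ' = -ζ' ∧ (∀ φ : Φ.1, 0 < (φ.1 ζ').im) ∧ CMTypeLattice.IsOfType 𝔪 ζ' 𝔣₀) ↔
        ∃ ζ' : K, IsCMField.complexConj K ζ' = -ζ' ∧ (∀ φ : Φ.1, 0 < (φ.1 ζ').im) ∧
          CMTypeLattice.IsOfType (1 : (FractionalIdeal (𝓞 K)⁰ K)ˣ) ζ' 𝔣₀ := fun 𝔣₀ => by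
    rcases h𝔪 with h | h
    · exact exists_pos_isOfType_iff_of_totallyPositive Φ 𝔪 (NonPrincipalLatticeLevel52.alpha_real_pos hζ).1
        (NonPrincipalLatticeLevel52.alpha_real_pos hζ).2 (NonPrincipalLatticeLevel52.mul_conjIdeal_eq_of_coe_eq hζ 𝔪 h) 𝔣₀
    · exact exists_pos_isOfType_iff_of_totallyPositive Φ 𝔪 (NonPrincipalLatticeLevel52.alpha_real_pos hζ).1
        (NonPrincipalLatticeLevel52.alpha_real_pos hζ).2
        (NonPrincipalLatticeLevel52.mul_conjIdeal_eq_of_coe_eq_conj hζ 𝔪 h) 𝔣₀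
  rw [htr ⊤, htr (Ideal.span {ϖ₀})]
  have hg : Nat.totient 52 = 2 * (11 + 1) := by decide
  exact xor_principal_span_of_norm_neg Φ 1 (complexConj_xi hζ hg) (xi_ne_zero hζ 11) (isOfType_one_xi_top hζ 11) hneg
    (norm_realUnits_pos_fiftyTwo hζ) (exists_units_sign_eq_fiftyTwo hζ Φ)

end Level52

end Summit.HodgeConjecture.Ring2WeilCoverage.TypeNormSignLevels40and52

end
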